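import Mathlib
import HarnessLib
import Summits.NavierStokesRegularity.NavierStokesRegularity.Theorems.UnthreadedDoorCellFluxGaugeRigidityAlgebra

/-!
# Route `UnthreadedDoor`, crux `PoloidalLiouville` (stmt-NavierStokesRegularity-1222), WALL W1 — crux idea «cell-flux» (ns-idea-14): toolkit for
# Σ-4 — the RADIAL PROJECTION kills the derivative of a function with RADIAL gradient on the sphere (local constancy on sphere-critical patches)

Support calculus for the cell-flux chain's hidden lemma `netFlux ≤ clusterFlux` (ns-qj-p1 g7's Σ-4 typing note, 2026-08-29): on a relatively open
patch of the sphere `S_r(x₀)` where `∇f × (x − x₀) = 0` (tangential gradient zero), `f` is LOCALLY CONSTANT along the sphere.  Proof without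
geodesics: compose `f` with the radial projection `ρ x = x₀ + (r/‖x − x₀‖)•(x − x₀)`; `ρ` maps into the sphere, so `⟪ρ x − x₀, Dρ(x)v⟫ = 0`
(differentiate `‖ρ x − x₀‖² ≡ r²`), and `∇f(ρ x) ∥ ρ x − x₀` kills `Dρ(x)v` (BAC–CAB), so `D(f ∘ ρ) = 0` on an open cone, hence `f ∘ ρ` is constant
on small balls (`IsOpen.is_const_of_fderiv_eq_zero`), and `ρ = id` on the sphere.
* `cross_cross_self`, `inner_eq_zero_of_cross_eq_zero` (BAC–CAB and its consequence), `radialProj_mem_sphere`, `radialProj_eq_self`,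
  `differentiableAt_radialProj`, `inner_fderiv_radialProj`, `fderiv_comp_radialProj_eq_zero`, **`exists_ball_eq_of_sphCrit_patch`**.
Nothing here is specific to Navier–Stokes; no NS regularity statement is proved.  `--supports stmt-NavierStokesRegularity-1222 --as helper`.  [folklore]
-/

noncomputable section

-- the summit and its single sub-problem share the name (CONVENTIONS §1)
set_option linter.dupNamespace false

open Set Function Filter Topology InnerProductSpace Metric
open scoped RealInnerProductSpace

namespace Summit.NavierStokesRegularity.NavierStokesRegularity.Theorems.PoloidalLiouville.CellFlux

open Literature.Analysis Literature.Analysis.FluidPDE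
open Summit.NavierStokesRegularity.NavierStokesRegularity.Theorems.PoloidalLiouville.HorizonTower (E3 cross_fin3)
open Literature.Geometry.DiscreteGeometry (inner_fin3)

/-! ### BAC–CAB -/

/-- `w × (g × w) = ⟪w, w⟫ g − ⟪w, g⟫ w`. [folklore] -/
theorem cross_cross_self (w g : E3) : cross w (cross g w) = ⟪w, w⟫ • g - ⟪w, g⟫ • w := by
  obtain ⟨p0, p1, p2⟩ := cross_fin3 g w
  obtain ⟨q0, q1, q2⟩ := cross_fin3 w (cross g w)
  ext i
  fin_cases i <;>
    simp only [PiLp.sub_apply, PiLp.smul_apply, smul_eq_mul, inner_fin3, Fin.zero_eta, Fin.mk_one, Fin.reduceFinMk, Fin.isValue] <;>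
    simp only [q0, q1, q2, p0, p1, p2] <;> ring

/-- If `g × w = 0`, `w ≠ 0` and `u ⊥ w`, then `⟪g, u⟫ = 0` (`g` is parallel to `w`). [folklore] -/
theorem inner_eq_zero_of_cross_eq_zero {g w u : E3} (hgw : cross g w = 0) (hw : w ≠ 0) (hwu : ⟪w, u⟫ = 0) : ⟪g, u⟫ = 0 := by
  have h := cross_cross_self w g
  have hz : cross w (cross g w) = 0 := by
    rw [hgw]
    obtain ⟨c0, c1, c2⟩ := cross_fin3 w (0 : E3)
    simp only [PiLp.zero_apply, mul_zero, sub_zero] at c0 c1 c2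
    ext i
    fin_cases i
    · exact c0
    · exact c1
    · exact c2
  rw [hz] at h
  -- `⟪w,w⟫ g = ⟪w,g⟫ w`; pair with `u`
  have h2 : ⟪w, w⟫ • g = ⟪w, g⟫ • w := (sub_eq_zero.1 h.symm)
  have h3 : ⟪w, w⟫ * ⟪g, u⟫ = ⟪w, g⟫ * ⟪w, u⟫ := by
    have := congrArg (fun z : E3 => ⟪z, u⟫) h2
    simpa only [real_inner_smul_left] using this
  rw [hwu, mul_zero] at h3
  have hww : ⟪w, w⟫ ≠ 0 := by
    rw [real_inner_self_eq_norm_sq]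
    exact pow_ne_zero _ (norm_ne_zero_iff.2 hw)
  exact (mul_eq_zero.1 h3).resolve_left hww

/-! ### The radial projection onto `S_r(x₀)` -/

/-- The radial projection lands on the sphere. [folklore] -/
theorem radialProj_mem_sphere {x₀ x : E3} {r : ℝ} (hr : 0 < r) (hx : x ≠ x₀) :
    x₀ + (r / ‖x - x₀‖) • (x - x₀) ∈ sphere x₀ r := by
  have hn : ‖x - x₀‖ ≠ 0 := norm_ne_zero_iff.2 (sub_ne_zero.2 hx)
  rw [mem_sphere_iff_norm, add_sub_cancel_left, norm_smul, Real.norm_eq_abs, abs_of_pos (div_pos hr (norm_pos_iff.2 (sub_ne_zero.2 hx))),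
    div_mul_cancel₀ _ hn]

/-- The radial projection is the identity on the sphere. [folklore] -/
theorem radialProj_eq_self {x₀ x : E3} {r : ℝ} (hr : 0 < r) (hx : x ∈ sphere x₀ r) :
    x₀ + (r / ‖x - x₀‖) • (x - x₀) = x := by
  rw [mem_sphere_iff_norm] at hx
  rw [hx, div_self hr.ne', one_smul, add_sub_cancel]

/-- The radial projection is differentiable away from the centre. [folklore] -/
theorem differentiableAt_radialProj {x₀ x : E3} (r : ℝ) (hx : x ≠ x₀) :
    DifferentiableAt ℝ (fun z : E3 => x₀ + (r / ‖z - x₀‖) • (z - x₀)) x := by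
  have hsub : DifferentiableAt ℝ (fun z : E3 => z - x₀) x := differentiableAt_id.sub_const x₀
  have hnorm : DifferentiableAt ℝ (fun z : E3 => ‖z - x₀‖) x := hsub.norm ℝ (sub_ne_zero.2 hx)
  have hinv : DifferentiableAt ℝ (fun z : E3 => r / ‖z - x₀‖) x := by
    simp_rw [div_eq_mul_inv]
    exact (hnorm.inv (norm_ne_zero_iff.2 (sub_ne_zero.2 hx))).const_mul r
  exact (differentiableAt_const x₀).add (hinv.smul hsub)

/-- **Tangency**: the derivative of the radial projection is orthogonal to the radius, `⟪ρ x − x₀, Dρ(x) v⟫ = 0`. [folklore] -/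
theorem inner_fderiv_radialProj {x₀ x : E3} {r : ℝ} (hr : 0 < r) (hx : x ≠ x₀) (v : E3) :
    ⟪x₀ + (r / ‖x - x₀‖) • (x - x₀) - x₀, fderiv ℝ (fun z : E3 => x₀ + (r / ‖z - x₀‖) • (z - x₀)) x v⟫ = 0 := by
  set ρ : E3 → E3 := fun z => x₀ + (r / ‖z - x₀‖) • (z - x₀) with hρ
  have hd : DifferentiableAt ℝ ρ x := differentiableAt_radialProj r hx
  have hd' : HasFDerivAt (fun z => ρ z - x₀) (fderiv ℝ ρ x) x := hd.hasFDerivAt.sub_const x₀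
  -- `‖ρ z − x₀‖² = r²` near `x`
  have hconst : (fun z => ‖ρ z - x₀‖ ^ 2) =ᶠ[𝓝 x] fun _ => r ^ 2 := by
    filter_upwards [isOpen_compl_singleton.mem_nhds hx] with z hz
    have hz' : z ≠ x₀ := hz
    have := radialProj_mem_sphere hr hz'
    rw [mem_sphere_iff_norm] at this
    rw [this]
  have h1 : HasFDerivAt (fun z => ‖ρ z - x₀‖ ^ 2) (2 • (innerSL ℝ (ρ x - x₀)).comp (fderiv ℝ ρ x)) x := hd'.norm_sq
  have h2 : HasFDerivAt (fun z => ‖ρ z - x₀‖ ^ 2) (0 : E3 →L[ℝ] ℝ) x :=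
    (hasFDerivAt_const (r ^ 2) x).congr_of_eventuallyEq hconst
  have h3 : 2 • (innerSL ℝ (ρ x - x₀)).comp (fderiv ℝ ρ x) = 0 := h1.unique h2
  have h4 : (2 • (innerSL ℝ (ρ x - x₀)).comp (fderiv ℝ ρ x)) v = (0 : E3 →L[ℝ] ℝ) v := by rw [h3]
  change 2 • ⟪ρ x - x₀, fderiv ℝ ρ x v⟫ = 0 at h4
  show ⟪ρ x - x₀, fderiv ℝ ρ x v⟫ = 0
  exact (smul_eq_zero.1 h4).resolve_left (by norm_num)

/-- **The radial projection kills the derivative of a function with radial gradient**: if `∇f(ρ x) × (ρ x − x₀) = 0` then `D(f ∘ ρ)(x) = 0`.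
[folklore] -/
theorem fderiv_comp_radialProj_eq_zero {f : E3 → ℝ} {x₀ x : E3} {r : ℝ} (hr : 0 < r) (hx : x ≠ x₀)
    (hf : DifferentiableAt ℝ f (x₀ + (r / ‖x - x₀‖) • (x - x₀)))
    (hcrit : cross (gradient f (x₀ + (r / ‖x - x₀‖) • (x - x₀))) (x₀ + (r / ‖x - x₀‖) • (x - x₀) - x₀) = 0) :
    fderiv ℝ (f ∘ fun z : E3 => x₀ + (r / ‖z - x₀‖) • (z - x₀)) x = 0 := by
  have hd : DifferentiableAt ℝ (fun z : E3 => x₀ + (r / ‖z - x₀‖) • (z - x₀)) x := differentiableAt_radialProj r hx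
  rw [fderiv_comp x hf hd]
  refine ContinuousLinearMap.ext fun v => ?_
  change fderiv ℝ f (x₀ + (r / ‖x - x₀‖) • (x - x₀)) (fderiv ℝ (fun z : E3 => x₀ + (r / ‖z - x₀‖) • (z - x₀)) x v) = 0
  have hne : x₀ + (r / ‖x - x₀‖) • (x - x₀) - x₀ ≠ 0 := by
    intro h0
    have := radialProj_mem_sphere hr hx
    rw [mem_sphere_iff_norm, h0, norm_zero] at this
    exact hr.ne' this.symm
  have htan := inner_fderiv_radialProj hr hx v
  have hgrad : fderiv ℝ f (x₀ + (r / ‖x - x₀‖) • (x - x₀)) (fderiv ℝ (fun z : E3 => x₀ + (r / ‖z - x₀‖) • (z - x₀)) x v) =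
      ⟪gradient f (x₀ + (r / ‖x - x₀‖) • (x - x₀)), fderiv ℝ (fun z : E3 => x₀ + (r / ‖z - x₀‖) • (z - x₀)) x v⟫ := by
    rw [gradient, InnerProductSpace.toDual_symm_apply]
  rw [hgrad]
  exact inner_eq_zero_of_cross_eq_zero hcrit hne htan

/-- **Local constancy on a sphere-critical patch.**  `f ∈ C¹` off `x₀`, `V` open, and `∇f(q) × (q − x₀) = 0` for every `q ∈ S_r(x₀) ∩ V`: then every
`q ∈ S_r(x₀) ∩ V` has a ball on which `f|_{S_r}` is constant. [folklore] -/
theorem exists_ball_eq_of_sphCrit_patch {f : E3 → ℝ} {x₀ : E3} {r : ℝ} (hr : 0 < r) (hf : ContDiffOn ℝ 1 f ({x₀}ᶜ : Set E3))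
    {V : Set E3} (hV : IsOpen V) (hcrit : ∀ q ∈ sphere x₀ r ∩ V, cross (gradient f q) (q - x₀) = 0)
    {q : E3} (hq : q ∈ sphere x₀ r ∩ V) :
    ∃ ε > 0, ∀ q' ∈ sphere x₀ r, dist q' q < ε → f q' = f q := by
  set ρ : E3 → E3 := fun z => x₀ + (r / ‖z - x₀‖) • (z - x₀) with hρ
  have hqx : q ≠ x₀ := ne_of_mem_sphere hq.1 hr.ne'
  -- the open cone `Ω = {z ≠ x₀ : ρ z ∈ V}`
  have hρc : ContinuousOn ρ ({x₀}ᶜ : Set E3) := fun z hz => (differentiableAt_radialProj r hz).continuousAt.continuousWithinAt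
  have hΩ : IsOpen (({x₀}ᶜ : Set E3) ∩ ρ ⁻¹' V) := hρc.isOpen_inter_preimage isOpen_compl_singleton hV
  have hqΩ : q ∈ ({x₀}ᶜ : Set E3) ∩ ρ ⁻¹' V := ⟨hqx, by rw [mem_preimage, hρ]; simpa only using (radialProj_eq_self hr hq.1).symm ▸ hq.2⟩
  obtain ⟨ε, hε, hball⟩ := Metric.isOpen_iff.1 hΩ q hqΩ
  refine ⟨ε, hε, fun q' hq' hd => ?_⟩
  -- `f ∘ ρ` has zero derivative on the ball
  have hfd : ∀ z ∈ ball q ε, DifferentiableAt ℝ f (ρ z) := fun z hz => by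
    have hz := hball hz
    have hs : ρ z ∈ sphere x₀ r := radialProj_mem_sphere hr hz.1
    have hne : ρ z ≠ x₀ := ne_of_mem_sphere hs hr.ne'
    exact (hf.differentiableOn one_ne_zero (ρ z) hne).differentiableAt (isOpen_compl_singleton.mem_nhds hne)
  have hdiff : DifferentiableOn ℝ (f ∘ ρ) (ball q ε) := fun z hz =>
    ((hfd z hz).comp z (differentiableAt_radialProj r (hball hz).1)).differentiableWithinAt
  have hzero : (ball q ε).EqOn (fderiv ℝ (f ∘ ρ)) 0 := fun z hz => by
    have hzΩ := hball hz
    have hs : ρ z ∈ sphere x₀ r := radialProj_mem_sphere hr hzΩ.1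
    exact fderiv_comp_radialProj_eq_zero hr hzΩ.1 (hfd z hz) (by
      have := hcrit (ρ z) ⟨hs, hzΩ.2⟩
      simpa only [hρ, add_sub_cancel_left] using this)
  have hconst := isOpen_ball.is_const_of_fderiv_eq_zero (convex_ball q ε).isPreconnected hdiff hzero
    (mem_ball.2 hd) (mem_ball_self hε)
  -- `ρ = id` on the sphere
  have e1 : (f ∘ ρ) q' = f q' := by simp only [comp_apply, hρ, radialProj_eq_self hr hq']
  have e2 : (f ∘ ρ) q = f q := by simp only [comp_apply, hρ, radialProj_eq_self hr hq.1]
  rw [← e1, ← e2]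
  exact hconst

end Summit.NavierStokesRegularity.NavierStokesRegularity.Theorems.PoloidalLiouville.CellFlux

end
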